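import Summits.ResolutionOfSingularities.ResolutionOfSingularities.Theorems.HomologicalConductorNoZenoStrictTransformM
import Literature.AlgebraicGeometry.Resolution.RegularLocalRingsQuotient
import Literature.AlgebraicGeometry.Resolution.RegularLocalRingsNormal
import Literature.AlgebraicGeometry.Resolution.PointBlowupHsFunMono
import Literature.AlgebraicGeometry.Resolution.MarkedIdeals
import HarnessLib

/-!
# Crux `NoZenoR` (stmt-ResolutionOfSingularities-19943), slot 5 (B1) `stub_L1wCoreF3`, seam2 ROUTE M:
# CASE A («`g^*[E] = [E′]` near `E′`») transfers REGULARITY of `E′` down to `E`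

OURS (cell res-hironaka, crux chain W4.4, lead res-L0-w44-lead-1 gen 9); nothing here is a statement of the manuscript
under review (Hironaka 2017); AI-written, weaker than expert review.  SUPPORT-level, counted 0.  Def-free, FACT-FREE.

SETTING (pv-045 `…NoZenoStrictTransformM` §3): `g : X′ → X` a dominant morphism of integral schemes, `η′ ∈ X′`,
`E := E_{g η′}`, `E′ := E_{η′}` with invertible prime-divisor ideals (`hF`, `hF'`), `F := g^*[E] − [E′]`.
CASE A of the lead's `caseA_of_not_three_mul_h0_lt` (p568621) is «`F` avoids every point of `closure {η′}`».

* `not_stalkIdeal_le_sq_of_avoids` — at a point `t` of `E′` which `F` AVOIDS and at which `E′` is REGULAR in the ambient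
  sense (`(𝓘_{E′})_t ⊄ 𝔪_t²`: the local equation is a regular parameter), `E` is regular at `g t` in the same sense
  (`(𝓘_E)_{g t} ⊄ 𝔪_{g t}²`): the local equation `d` of `E` pulls back to `(unit)·e`, `e` the local equation of `E′`, and
  local homomorphisms carry `𝔪²` into `𝔪²`.
* `forall_not_stalkIdeal_le_sq_of_caseA` — with `g` universally closed, Case A + `E′` regular at every point ⇒ `E`
  regular at every point of `closure {g η′}` (closedness lifts points of `E` to points of `E′`).
* `isRegularLocalRing_stalk_ofPoint`, `isIntegrallyClosed_stalk_ofPoint` — on a REGULAR ambient `X`, «`(𝓘_E)_p ⊄ 𝔪_p²` at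
  every point» makes every local ring of the integral curve `E = ClosedSubvariety.ofPoint X η` regular, hence integrally
  closed (Matsumura 14.2 / 19.4 via the tree's `IsRegularLocalRing.quotient_span_singleton`,
  `isIntegrallyClosed_of_isRegularLocalRing`, `isRegularLocalRing_stalk_subscheme_iff`).
Consumed with the companion `…NoZenoCaseAConstantField` (normal `E` ⇒ `h⁰(E′) ≤ h⁰(E)`) to kill Case A for regular
`E′` (node curves), i.e. «first-kind curves are contracted by a morphism onto a resolution all of whose curves satisfy (M)».

References: H. Matsumura, *Commutative Ring Theory* (1986), Thm. 14.2, Thm. 19.4 [`Matsumura1987`]; U. Görtz,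
T. Wedhorn, *Algebraic Geometry I* (2020), (11.9) [`GortzWedhorn2020`].
-/

noncomputable section

-- single-problem summit: the doubled namespace component `ResolutionOfSingularities` is forced
set_option linter.dupNamespace false

namespace Summit.ResolutionOfSingularities.ResolutionOfSingularities.Theorems.NoZeno.ExcCount

open CategoryTheory AlgebraicGeometry TopologicalSpace IsLocalRing
open Literature.AlgebraicGeometry.Resolution Literature.AlgebraicGeometry.Motives
open Literature.AlgebraicGeometry.Motives.RatFn

/-! ## §1 Local homomorphisms and `𝔪²` -/

section LocalSq

variable {A B : Type*} [CommRing A] [CommRing B] [IsLocalRing A] [IsLocalRing B]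

/-- A local homomorphism carries `𝔪_A²` into `𝔪_B²`. [folklore] -/
theorem map_maximalIdeal_sq_le (φ : A →+* B) [IsLocalHom φ] :
    ((maximalIdeal A) ^ 2).map φ ≤ (maximalIdeal B) ^ 2 := by
  rw [Ideal.map_pow]
  refine Ideal.pow_right_mono ?_ 2
  rw [Ideal.map_le_iff_le_comap]
  intro a ha
  rw [Ideal.mem_comap, mem_maximalIdeal, mem_nonunits_iff]
  exact fun hu => ha ((isUnit_map_iff φ a).mp hu)

/-- If `u` is a unit and `u * e ∈ 𝔪²` then `e ∈ 𝔪²`. [folklore] -/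
theorem mem_sq_of_unit_mul_mem {u e : B} (hu : IsUnit u) (h : u * e ∈ (maximalIdeal B) ^ 2) :
    e ∈ (maximalIdeal B) ^ 2 := by
  obtain ⟨v, rfl⟩ := hu
  have : e = ((v⁻¹ : Bˣ) : B) * ((v : B) * e) := by
    rw [← mul_assoc, Units.inv_mul, one_mul]
  rw [this]
  exact Ideal.mul_mem_left _ _ h

end LocalSq

/-! ## §2 Case A transfers regularity of `E′` at `t` to regularity of `E` at `g t` -/

section Transfer

variable {X X' : Scheme.{0}} [IsIntegral X] [IsIntegral X'] (g : X' ⟶ X) [IsDominant g] {η' : X'}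
  (hF : IsEffectiveCartier (primeDivisorIdeal (g.base η')))
  (hF' : IsEffectiveCartier (primeDivisorIdeal η'))

/-- **Case A at a point transfers regularity down.**  If `F = g^*[E] − [E′]` avoids `t` and the local equation of
`E′` at `t` is NOT in `𝔪_t²`, then the local equation of `E = E_{g η′}` at `g t` is not in `𝔪_{g t}²`. [folklore] -/
theorem not_stalkIdeal_le_sq_of_avoids {t : X'}
    (hA : ((CartierDivisor.ofIsEffectiveCartier (primeDivisorIdeal (g.base η')) hF).pullback g +
      -CartierDivisor.ofIsEffectiveCartier (primeDivisorIdeal η') hF').Avoids t)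
    (hreg : ¬ stalkIdeal (primeDivisorIdeal η') t ≤ (maximalIdeal (X'.presheaf.stalk t)) ^ 2) :
    ¬ stalkIdeal (primeDivisorIdeal (g.base η')) (g.base t) ≤ (maximalIdeal (X.presheaf.stalk (g.base t))) ^ 2 := by
  intro hle
  obtain ⟨i, hi⟩ := (CartierDivisor.ofIsEffectiveCartier (primeDivisorIdeal (g.base η')) hF).covers (g.base t)
  obtain ⟨j, hj⟩ := (CartierDivisor.ofIsEffectiveCartier (primeDivisorIdeal η') hF').covers t
  -- the local equation of `F` at `t` on the chart `(i, j)` is a unit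
  obtain ⟨u, hu⟩ := hA (i, j) ⟨hi, hj⟩
  change toFunctionField t (u : X'.presheaf.stalk t) =
    functionFieldMap g ((CartierDivisor.ofIsEffectiveCartier (primeDivisorIdeal (g.base η')) hF).f i) *
      ((CartierDivisor.ofIsEffectiveCartier (primeDivisorIdeal η') hF').f j)⁻¹ at hu
  -- generators of the two stalk ideals
  obtain ⟨d, hd, hdspan⟩ := exists_germ_localEquation_span (primeDivisorIdeal (g.base η')) hF i hi
  obtain ⟨e, he, hespan⟩ := exists_germ_localEquation_span (primeDivisorIdeal η') hF' j hj
  have he0 : toFunctionField t e ≠ 0 := by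
    rw [he]
    exact (CartierDivisor.ofIsEffectiveCartier (primeDivisorIdeal η') hF').f_ne_zero j
  -- `u * e = g♯ d` in `𝒪_{X′,t}`
  have hue : (u : X'.presheaf.stalk t) * e = g.stalkMap t d := by
    apply toFunctionField_injective t
    rw [map_mul, hu, ← hd, functionFieldMap_toFunctionField, ← he, mul_assoc, inv_mul_cancel₀ he0, mul_one]
  -- `d ∈ 𝔪_{g t}²`, so `g♯ d ∈ 𝔪_t²`, so `e ∈ 𝔪_t²`
  have hd2 : d ∈ (maximalIdeal (X.presheaf.stalk (g.base t))) ^ 2 :=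
    hle (by rw [hdspan]; exact Ideal.mem_span_singleton_self d)
  have hgd2 : (g.stalkMap t).hom d ∈ (maximalIdeal (X'.presheaf.stalk t)) ^ 2 :=
    map_maximalIdeal_sq_le (g.stalkMap t).hom (Ideal.mem_map_of_mem _ hd2)
  have he2 : e ∈ (maximalIdeal (X'.presheaf.stalk t)) ^ 2 :=
    mem_sq_of_unit_mul_mem u.isUnit (by rw [hue]; exact hgd2)
  apply hreg
  rw [hespan, Ideal.span_singleton_le_iff_mem]
  exact he2

/-- **CASE A transfers regularity of `E′` to `E` everywhere.**  `g` universally closed (e.g. proper); `F` avoids every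
point of `closure {η′}` (Case A); `E′` regular at every point in the ambient sense.  Then `E = E_{g η′}` is regular in
the ambient sense at every point of `closure {g η′}` (each such point is the image of a point of `closure {η′}`,
`g` being closed). [folklore] -/
theorem forall_not_stalkIdeal_le_sq_of_caseA [UniversallyClosed g]
    (hA : ∀ t : X', η' ⤳ t →
      ((CartierDivisor.ofIsEffectiveCartier (primeDivisorIdeal (g.base η')) hF).pullback g +
        -CartierDivisor.ofIsEffectiveCartier (primeDivisorIdeal η') hF').Avoids t)
    (hreg : ∀ t : X', η' ⤳ t → ¬ stalkIdeal (primeDivisorIdeal η') t ≤ (maximalIdeal (X'.presheaf.stalk t)) ^ 2) :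
    ∀ p : X, g.base η' ⤳ p →
      ¬ stalkIdeal (primeDivisorIdeal (g.base η')) p ≤ (maximalIdeal (X.presheaf.stalk p)) ^ 2 := by
  intro p hp
  -- `p ∈ closure {g η′} ⊆ g '' closure {η′}`
  have hclosed : IsClosed (g.base '' closure ({η'} : Set X')) :=
    g.isClosedMap _ isClosed_closure
  have hsub : closure ({g.base η'} : Set X) ⊆ g.base '' closure ({η'} : Set X') := by
    rw [IsClosed.closure_subset_iff hclosed, Set.singleton_subset_iff]
    exact ⟨η', subset_closure (Set.mem_singleton _), rfl⟩
  obtain ⟨t, ht, rfl⟩ := hsub (specializes_iff_mem_closure.mp hp)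
  have ht' : η' ⤳ t := specializes_iff_mem_closure.mpr ht
  exact not_stalkIdeal_le_sq_of_avoids g hF hF' (hA t ht') (hreg t ht')

end Transfer

/-! ## §3 Ambient regularity `(𝓘_E)_p ⊄ 𝔪_p²` on a regular `X` makes the curve `E` regular and normal -/

section CurveRegular

variable {X : Scheme.{0}} [IsIntegral X] {η : X}

/-- On a regular `X`, if the stalk ideal of the prime divisor `E = E_η` at `p = ι y` is not inside `𝔪_p²`, the local ring
of the integral curve `E = ClosedSubvariety.ofPoint X η` at `y` is a regular local ring (`𝒪_{E,y} ≅ 𝒪_{X,p}/(d)` with `d`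
a regular parameter; Matsumura 14.2). [cite: Matsumura1987, Thm. 14.2] -/
theorem isRegularLocalRing_stalk_ofPoint (hX : Scheme.IsRegular X) (hF : IsEffectiveCartier (primeDivisorIdeal η))
    (y : (ClosedSubvariety.ofPoint X η).carrier)
    (hreg : ¬ stalkIdeal (primeDivisorIdeal η) ((ClosedSubvariety.ofPoint X η).ι.base y) ≤
      (maximalIdeal (X.presheaf.stalk ((ClosedSubvariety.ofPoint X η).ι.base y))) ^ 2) :
    IsRegularLocalRing ((ClosedSubvariety.ofPoint X η).carrier.presheaf.stalk y) := by
  set p := (ClosedSubvariety.ofPoint X η).ι.base y with hp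
  haveI : IsRegularLocalRing (X.presheaf.stalk p) := hX p
  -- a generator `d` of the stalk ideal
  obtain ⟨i, hi⟩ := (CartierDivisor.ofIsEffectiveCartier (primeDivisorIdeal η) hF).covers p
  obtain ⟨d, -, hdspan⟩ := exists_germ_localEquation_span (primeDivisorIdeal η) hF i hi
  have hdm : d ∈ maximalIdeal (X.presheaf.stalk p) := by
    -- the stalk ideal is proper: `p` lies in the support `closure {η}`
    have hle : stalkIdeal (primeDivisorIdeal η) p ≤ maximalIdeal (X.presheaf.stalk p) := by
      rw [← mem_support_iff_stalkIdeal_le, mem_support_primeDivisorIdeal_iff]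
      exact ClosedSubvariety.specializes_ofPoint_ι η y
    exact hle (by rw [hdspan]; exact Ideal.mem_span_singleton_self d)
  have hd2 : d ∉ (maximalIdeal (X.presheaf.stalk p)) ^ 2 := fun h => hreg (by
    rw [hdspan, Ideal.span_singleton_le_iff_mem]; exact h)
  have hq := (IsRegularLocalRing.quotient_span_singleton hdm hd2).1
  rw [← hdspan] at hq
  exact (isRegularLocalRing_stalk_subscheme_iff (primeDivisorIdeal η) y).mpr hq

/-- … hence integrally closed (Matsumura 19.4). [cite: Matsumura1987, Thm. 19.4] -/
theorem isIntegrallyClosed_stalk_ofPoint (hX : Scheme.IsRegular X) (hF : IsEffectiveCartier (primeDivisorIdeal η))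
    (y : (ClosedSubvariety.ofPoint X η).carrier)
    (hreg : ¬ stalkIdeal (primeDivisorIdeal η) ((ClosedSubvariety.ofPoint X η).ι.base y) ≤
      (maximalIdeal (X.presheaf.stalk ((ClosedSubvariety.ofPoint X η).ι.base y))) ^ 2) :
    IsIntegrallyClosed ((ClosedSubvariety.ofPoint X η).carrier.presheaf.stalk y) := by
  haveI := isRegularLocalRing_stalk_ofPoint hX hF y hreg
  exact isIntegrallyClosed_of_isRegularLocalRing _

/-- **All local rings of `E` are integrally closed** when `X` is regular and `(𝓘_E)_p ⊄ 𝔪_p²` along `closure {η}`.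
[cite: Matsumura1987, Thm. 14.2 and Thm. 19.4] -/
theorem forall_isIntegrallyClosed_stalk_ofPoint (hX : Scheme.IsRegular X) (hF : IsEffectiveCartier (primeDivisorIdeal η))
    (hreg : ∀ p : X, η ⤳ p → ¬ stalkIdeal (primeDivisorIdeal η) p ≤ (maximalIdeal (X.presheaf.stalk p)) ^ 2) :
    ∀ y : (ClosedSubvariety.ofPoint X η).carrier,
      IsIntegrallyClosed ((ClosedSubvariety.ofPoint X η).carrier.presheaf.stalk y) :=
  fun y => isIntegrallyClosed_stalk_ofPoint hX hF y (hreg _ (ClosedSubvariety.specializes_ofPoint_ι η y))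

end CurveRegular

end Summit.ResolutionOfSingularities.ResolutionOfSingularities.Theorems.NoZeno.ExcCount

end
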